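import Literature.Analysis.Complex.ArgumentPrincipleRectangle
import HarnessLib

/-!
# The residue theorem on a rectangle for finitely many simple poles

Trunk T-ANALYSIS support (`Literature/Analysis/Complex`). The tree has Cauchy–Goursat and Cauchy's
integral formula for rectangles (`Literature.Analysis.Complex.rectBoundaryIntegral_eq_zero_of_differentiableOn`,
`Literature.Analysis.Complex.integral_boundary_rect_div_sub_eq`), the winding integral
`∮ m/(z−ρ) = 2πi m` (`Literature.Analysis.Complex.rectBoundaryIntegral_const_mul_inv_sub`) and the
(weighted) argument principle, but no residue theorem for a general meromorphic integrand. This file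
proves the case needed by explicit formulae of "`1/ζ` type" (poles at the zeros of a denominator,
NOT of the form `f'/f`): **finitely many simple poles inside the rectangle**.

* `Literature.Analysis.Complex.rectBoundaryIntegral_eq_sum_of_simplePoles` — let `K = [a,b] × [c,d]`,
  `U ⊇ K` open, `S ⊆ K°` finite, `F` complex differentiable on `U ∖ S`, and suppose that at every
  `p ∈ S` the function has a simple pole in the concrete sense
  `F(z) = φ_p(z)/(z − p)` on a punctured neighbourhood of `p`, with `φ_p` differentiable on a
  neighbourhood of `p`; then, in Mathlib's four-term boundary convention
  (bottom − top + i·right − i·left, `Literature.Analysis.Complex.rectBoundaryIntegral`),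
  `∮_{∂K} F = 2πi ∑_{p ∈ S} φ_p(p)`.

Proof: induction on `S` (as in `ArgumentPrincipleRectangle.lean`). For `p ∈ S`,
`F − φ_p(p)/(z−p) = (φ_p(z) − φ_p(p))/(z − p) = dslope φ_p p` near `p` is differentiable at `p`
(Mathlib's `differentiableOn_dslope`, the removable-singularity step), and at the other poles `q`
it is again of the form `ψ/(z−q)` with `ψ = φ_q − φ_p(p)(z−q)/(z−p)`; the induction hypothesis and
`∮ φ_p(p)/(z−p) = 2πi φ_p(p)` conclude. The base case is Cauchy–Goursat.

Textbook statement: the residue theorem (Conway, *Functions of One Complex Variable I*, V.2.2;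
Ahlfors, *Complex Analysis*, Ch. 4 §5.1) for a rectangle and first-order poles.

## References

* J. B. Conway, *Functions of One Complex Variable I*, 2nd ed., GTM 11, Springer 1978, Ch. V §2,
  Thm. 2.2 (Residue Theorem). [Conway1978]
-/

noncomputable section

open Complex Set MeasureTheory Filter Topology intervalIntegral

namespace Literature.Analysis.Complex

variable {a b c d : ℝ}

/-- A point of the open rectangle is not on the bottom or top edge. [folklore] -/
lemma ne_of_mem_Ioo_reProdIm_of_im {p z : ℂ} (hp : p ∈ Ioo a b ×ℂ Ioo c d)
    (hz : z.im = c ∨ z.im = d) : z ≠ p := by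
  rintro rfl
  rw [mem_reProdIm] at hp
  rcases hz with h | h
  · linarith [hp.2.1]
  · linarith [hp.2.2]

/-- A point of the open rectangle is not on the left or right edge. [folklore] -/
lemma ne_of_mem_Ioo_reProdIm_of_re {p z : ℂ} (hp : p ∈ Ioo a b ×ℂ Ioo c d)
    (hz : z.re = a ∨ z.re = b) : z ≠ p := by
  rintro rfl
  rw [mem_reProdIm] at hp
  rcases hz with h | h
  · linarith [hp.1.1]
  · linarith [hp.1.2]

/-- **Residue theorem on a rectangle, finitely many simple poles.** Let `K = [a,b] × [c,d]`
(`a < b`, `c < d`), `U ⊇ K` open, `S ⊆ K°` a finite set, `F : ℂ → ℂ` complex differentiable on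
`U ∖ S`, and suppose that for every `p ∈ S` there are a neighbourhood `V` of `p` and `φ`
differentiable on `V` with `F(z) = φ(z)/(z − p)` for `z ∈ V ∖ {p}` and `φ(p) = r(p)`. Then
`∮_{∂K} F = 2πi ∑_{p ∈ S} r(p)` (four-term convention of Mathlib). The values of `F` at the points
of `S` are irrelevant. [cite: Conway1978, Ch. V Thm. 2.2] -/
theorem rectBoundaryIntegral_eq_sum_of_simplePoles (hab : a < b) (hcd : c < d) (S : Finset ℂ) :
    ∀ (F : ℂ → ℂ) (r : ℂ → ℂ) (U : Set ℂ), IsOpen U → Icc a b ×ℂ Icc c d ⊆ U →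
      ((S : Set ℂ) ⊆ Ioo a b ×ℂ Ioo c d) →
      DifferentiableOn ℂ F (U \ ↑S) →
      (∀ p ∈ S, ∃ φ : ℂ → ℂ, ∃ V ∈ 𝓝 p, DifferentiableOn ℂ φ V ∧ φ p = r p ∧
          ∀ z ∈ V, z ≠ p → F z = φ z / (z - p)) →
      rectBoundaryIntegral F a b c d = 2 * Real.pi * I * ∑ p ∈ S, r p := by
  classical
  induction S using Finset.induction_on with
  | empty =>
    intro F r U _ hKU _ hF _
    have hd : DifferentiableOn ℂ F (Icc a b ×ℂ Icc c d) :=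
      hF.mono (by simpa using hKU)
    rw [rectBoundaryIntegral_eq_zero_of_differentiableOn hab.le hcd.le hd]
    simp
  | insert p S' hpS' ih =>
    intro F r U hU hKU hsub hF hpole
    -- the pole `p`
    have hpK : p ∈ Ioo a b ×ℂ Ioo c d := hsub (Finset.mem_insert_self p S')
    obtain ⟨φ, V, hV, hφ, hφp, hFφ⟩ := hpole p (Finset.mem_insert_self p S')
    have hsub' : ((S' : Set ℂ) ⊆ Ioo a b ×ℂ Ioo c d) := fun q hq ↦
      hsub (Finset.mem_insert_of_mem hq)
    have hpS'c : ∀ q ∈ S', q ≠ p := fun q hq h ↦ hpS' (h ▸ hq)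
    -- the corrected function `F₁ = F - r p/(z-p)`, with the removable singularity at `p` filled
    set F₁ : ℂ → ℂ := fun z ↦ if z = p then deriv φ p else F z - r p / (z - p) with hF₁
    have hF₁_of_ne : ∀ {z : ℂ}, z ≠ p → F₁ z = F z - r p / (z - p) := fun hz ↦ by
      simp [hF₁, hz]
    -- `F₁ = dslope φ p` near `p`
    have hF₁V : ∀ z ∈ V, F₁ z = dslope φ p z := by
      intro z hz
      by_cases hzp : z = p
      · rw [hzp]
        simp [hF₁]
      · rw [hF₁_of_ne hzp, hFφ z hz hzp, dslope_of_ne _ hzp, slope_def_field, ← hφp]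
        field_simp [sub_ne_zero.2 hzp]
    have hF₁p : DifferentiableAt ℂ F₁ p := by
      have h1 : DifferentiableOn ℂ (dslope φ p) V := (differentiableOn_dslope hV).2 hφ
      have h2 : DifferentiableAt ℂ (dslope φ p) p := h1.differentiableAt hV
      refine h2.congr_of_eventuallyEq ?_
      filter_upwards [hV] with z hz using hF₁V z hz
    -- the open set on which `F` itself is differentiable
    have hOpen : IsOpen (U \ ↑(insert p S')) :=
      hU.sdiff (Finset.finite_toSet _).isClosed
    have hFat : ∀ {z : ℂ}, z ∈ U → z ∉ insert p S' → DifferentiableAt ℂ F z := by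
      intro z hzU hzS
      exact hF.differentiableAt (hOpen.mem_nhds ⟨hzU, by simpa using hzS⟩)
    -- differentiability of `F₁` on `U \ S'`
    have hF₁d : DifferentiableOn ℂ F₁ (U \ ↑S') := by
      intro z hz
      apply DifferentiableAt.differentiableWithinAt
      by_cases hzp : z = p
      · rw [hzp]; exact hF₁p
      · have hzS : z ∉ insert p S' := by
          simp only [Finset.mem_insert, not_or]
          exact ⟨hzp, by simpa using hz.2⟩
        have hG : DifferentiableAt ℂ (fun w ↦ F w - r p / (w - p)) z :=
          (hFat hz.1 hzS).sub ((differentiableAt_const _).div (differentiableAt_id.sub_const p)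
            (sub_ne_zero.2 hzp))
        refine hG.congr_of_eventuallyEq ?_
        filter_upwards [isOpen_ne.mem_nhds hzp] with w hw using hF₁_of_ne hw
    -- the pole data of `F₁` at the remaining poles
    have hpole₁ : ∀ q ∈ S', ∃ ψ : ℂ → ℂ, ∃ W ∈ 𝓝 q, DifferentiableOn ℂ ψ W ∧ ψ q = r q ∧
        ∀ z ∈ W, z ≠ q → F₁ z = ψ z / (z - q) := by
      intro q hq
      have hqp : q ≠ p := hpS'c q hq
      obtain ⟨ψ, W, hW, hψ, hψq, hFψ⟩ := hpole q (Finset.mem_insert_of_mem hq)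
      refine ⟨fun z ↦ ψ z - r p * (z - q) / (z - p), W ∩ {z | z ≠ p},
        inter_mem hW (isOpen_ne.mem_nhds hqp), ?_, ?_, ?_⟩
      · intro z hz
        have hzp : z ≠ p := hz.2
        exact ((hψ z hz.1).sub ((((differentiableAt_const _).mul
          (differentiableAt_id.sub_const q)).div (differentiableAt_id.sub_const p)
          (sub_ne_zero.2 hzp)).differentiableWithinAt)).mono inter_subset_left
      · simp [hψq]
      · intro z hz hzq
        have hzp : z ≠ p := hz.2
        rw [hF₁_of_ne hzp, hFψ z hz.1 hzq]
        field_simp [sub_ne_zero.2 hzq, sub_ne_zero.2 hzp]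
    -- induction hypothesis
    have hI := ih F₁ r U hU hKU hsub' hF₁d hpole₁
    -- continuity of the two pieces on `∂K`
    have hbdy : ∀ {z : ℂ}, z ∈ Icc a b ×ℂ Icc c d → (z.im = c ∨ z.im = d) ∨ (z.re = a ∨ z.re = b) →
        ContinuousAt F₁ z ∧ ContinuousAt (fun w ↦ r p * (w - p)⁻¹) z ∧
          F z = F₁ z + r p * (z - p)⁻¹ := by
      intro z hzK hz
      have hzp : z ≠ p := by
        rcases hz with h | h
        · exact ne_of_mem_Ioo_reProdIm_of_im hpK h
        · exact ne_of_mem_Ioo_reProdIm_of_re hpK h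
      have hzS' : z ∉ (S' : Set ℂ) := by
        intro h
        have h' := hsub' h
        rw [mem_reProdIm] at h'
        rcases hz with (h1 | h1) | (h1 | h1)
        · linarith [h'.2.1]
        · linarith [h'.2.2]
        · linarith [h'.1.1]
        · linarith [h'.1.2]
      have hzU : z ∈ U := hKU hzK
      refine ⟨?_, ?_, ?_⟩
      · exact (hF₁d.differentiableAt ((hU.sdiff (Finset.finite_toSet _).isClosed).mem_nhds
          ⟨hzU, hzS'⟩)).continuousAt
      · exact (continuousAt_const.mul ((continuousAt_id.sub continuousAt_const).inv₀
          (sub_ne_zero.2 hzp)))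
      · rw [hF₁_of_ne hzp, div_eq_mul_inv]
        ring
    have memK_h : ∀ {x : ℝ} (y : ℝ), x ∈ Icc a b → (y = c ∨ y = d) → (x : ℂ) + y * I ∈ Icc a b ×ℂ Icc c d := by
      intro x y hx hy
      rw [mem_reProdIm]
      refine ⟨by simpa using hx, ?_⟩
      rcases hy with rfl | rfl <;> simp [hcd.le]
    have memK_v : ∀ (x : ℝ) {y : ℝ}, (x = a ∨ x = b) → y ∈ Icc c d → (x : ℂ) + y * I ∈ Icc a b ×ℂ Icc c d := by
      intro x y hx hy
      rw [mem_reProdIm]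
      refine ⟨?_, by simpa using hy⟩
      rcases hx with rfl | rfl <;> simp [hab.le]
    have him : ∀ (x y : ℝ), ((x : ℂ) + y * I).im = y := fun x y ↦ by simp
    have hre : ∀ (x y : ℝ), ((x : ℂ) + y * I).re = x := fun x y ↦ by simp
    -- assemble
    have hcongr : rectBoundaryIntegral F a b c d =
        rectBoundaryIntegral (fun z ↦ F₁ z + r p * (z - p)⁻¹) a b c d := by
      refine rectBoundaryIntegral_congr hab.le hcd.le (fun x hx ↦ ?_) (fun x hx ↦ ?_)
        (fun y hy ↦ ?_) (fun y hy ↦ ?_)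
      · exact (hbdy (memK_h c hx (Or.inl rfl)) (Or.inl (Or.inl (him x c)))).2.2
      · exact (hbdy (memK_h d hx (Or.inr rfl)) (Or.inl (Or.inr (him x d)))).2.2
      · exact (hbdy (memK_v a (Or.inl rfl) hy) (Or.inr (Or.inl (hre a y)))).2.2
      · exact (hbdy (memK_v b (Or.inr rfl) hy) (Or.inr (Or.inr (hre b y)))).2.2
    have hadd : rectBoundaryIntegral (fun z ↦ F₁ z + r p * (z - p)⁻¹) a b c d =
        rectBoundaryIntegral F₁ a b c d + rectBoundaryIntegral (fun z ↦ r p * (z - p)⁻¹) a b c d :=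
      rectBoundaryIntegral_add hab.le hcd.le
        (fun x hx ↦ (hbdy (memK_h c hx (Or.inl rfl)) (Or.inl (Or.inl (him x c)))).1)
        (fun x hx ↦ (hbdy (memK_h d hx (Or.inr rfl)) (Or.inl (Or.inr (him x d)))).1)
        (fun y hy ↦ (hbdy (memK_v a (Or.inl rfl) hy) (Or.inr (Or.inl (hre a y)))).1)
        (fun y hy ↦ (hbdy (memK_v b (Or.inr rfl) hy) (Or.inr (Or.inr (hre b y)))).1)
        (fun x hx ↦ (hbdy (memK_h c hx (Or.inl rfl)) (Or.inl (Or.inl (him x c)))).2.1)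
        (fun x hx ↦ (hbdy (memK_h d hx (Or.inr rfl)) (Or.inl (Or.inr (him x d)))).2.1)
        (fun y hy ↦ (hbdy (memK_v a (Or.inl rfl) hy) (Or.inr (Or.inl (hre a y)))).2.1)
        (fun y hy ↦ (hbdy (memK_v b (Or.inr rfl) hy) (Or.inr (Or.inr (hre b y)))).2.1)
    have hwind := rectBoundaryIntegral_const_mul_inv_sub (r p) p hpK.1.1 hpK.1.2 hpK.2.1 hpK.2.2
    rw [hcongr, hadd, hI, hwind, Finset.sum_insert hpS']
    ring

end Literature.Analysis.Complex
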